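import Literature.Probability.LatticeModels.LatticeGreenRiemannSum
import Literature.Probability.LatticeModels.TorusFourierProofs
import HarnessLib

/-!
# Long-range order from an infrared bound and a diagonal lower bound (`d ≥ 3`)

Topic `Probability/LatticeModels`, namespace `Literature.Probability.LatticeModels`. Theorem-only file
(no definitions, no named facts): the abstract Fröhlich–Simon–Spencer mechanism by which an
INFRARED BOUND forces LONG-RANGE ORDER in `d ≥ 3` dimensions, in the finite-volume / subsequential
thermodynamic-limit form in which it is used for lattice models on the periodic boxes `(ℤ/Lℤ)^d`:

* J. Fröhlich, B. Simon, T. Spencer, *Infrared bounds, phase transitions and continuous symmetry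
  breaking*, Comm. Math. Phys. **50** (1976) 79–95, §3 (the sum rule `G(0) = ∫ Ĝ` against
  `Ĝ(p) ≤ const/(β E(p))` off `p = 0`, `∫ dp/E(p) < ∞` iff `d ≥ 3`);
* C. Borgs, E. Seiler, *Lattice Yang–Mills theory at nonzero temperature and the confinement
  problem*, Comm. Math. Phys. **91** (1983) 329–380, proof of Cor. III.5 (pp. 347–348): "Since
  `Ĝ(p) ≥ 0` it is the density of a measure and [the infrared bounds] say that it is absolutely
  continuous … except possibly at `p = 0`, where it may have a discrete contribution `cδ(p)`. In
  `d ≥ 3` [they] are compatible with [`∫ Ĝ ≥ 1`] only if `c > 0` for sufficiently large `J_E`.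
  `c > 0` implies long range order, that is `lim G(x) ≠ 0`."

We give the mechanism in an elementary form that avoids spectral measures (Bochner) and the
Riemann–Lebesgue lemma for the limit state: everything is finite Fourier analysis on `(ℤ/Lℤ)^d`
(the tree's `TorusFourierProofs.lean`) plus the tree's lattice Green function
(`LatticeGreenFunction.lean`, `LatticeGreenRiemannSum.lean`).

## The statements (all PROVED)

For a real function `G` on the torus `(ℤ/Lℤ)^d` with Fourier transform `Ĝ = torusFourier G`
(unnormalised, `Ĝ(0) = ∑_x G(x)`):

* `torusFourier_re_nonneg_of_posSemidef` — if `G` is positive definite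
  (`Re ∑_{x,y} c_x c̄_y G(x - y) ≥ 0` for complex `c`) then `Re Ĝ(k) ≥ 0` for every `k`
  ("`Ĝ(p) ≥ 0` because `G` is clearly positive definite", Borgs–Seiler p. 347);
* `sub_mul_torusGreen_le_zeroMode` — the **sum rule**: an infrared bound
  `ε(p_k) Re Ĝ(k) ≤ B` for `k ≠ 0` (`ε = dispersion`, `p_k = latticeMomentum L k`) gives
  `G(0) - B · torusGreen 0 ≤ L^{-d} Re Ĝ(0)`, where `torusGreen 0 = L^{-d} ∑_{k ≠ 0} ε(p_k)⁻¹` is the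
  tree's finite-volume Green function at the origin (Fourier inversion at `x = 0`);
* `sq_mul_le_blockSum` — hence, if moreover `Re Ĝ ≥ 0`, for every finite `Q ⊂ ℤ^d`,
  `|Q|² (G(0) - B · torusGreen 0) ≤ ∑_{x,y ∈ Q} G(x̄ - ȳ)` (`x̄ = x mod L`): the block double sums are
  bounded below by the zero mode (drop the `k ≠ 0` modes in
  `∑_{x,y ∈ Q} G(x̄ - ȳ) = L^{-d} ∑_k Re Ĝ(k) |1̂_Q(k)|²`);
* `le_blockSum_of_tendsto` / `not_tendsto_zero_of_infraredBound` — **long-range order in the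
  thermodynamic limit**: let `d ≥ 3`, let `G_n` be real functions on the even tori
  `(ℤ/L_nℤ)^d`, `L_n = 2φ(n) + 2 → ∞`, eventually positive definite in the above Fourier sense,
  with `G_n(0) ≥ g₀` and the infrared bound `ε(p_k) Re Ĝ_n(k) ≤ B` (`k ≠ 0`), and let `G∞` be a
  pointwise limit of `G_n(x mod L_n)` on `ℤ^d`. If `B · latticeGreen 0 < g₀`
  (`latticeGreen 0 = (2π)^{-d} ∫_{[-π,π]^d} dp/ε(p) < ∞`, the `I(d)`-type constant), then the block
  averages `|Λ_N|⁻² ∑_{x,y ∈ Λ_N} G∞(x - y)` are bounded below by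
  `c₀ = (g₀ - B · latticeGreen 0)/2 > 0` for every `N`, so `G∞(x) ↛ 0` as `|x| → ∞`
  (by the Cesàro lemma `tendsto_blockAverage_of_tendsto_cofinite`: a kernel decaying at infinity
  has vanishing block averages). The passage `torusGreen 0 → latticeGreen 0` along even `L` is the
  tree's `torusGreen_tendsto_latticeGreen`.

This is exactly the shape consumed by `Literature.Barriers.QuantumFields.FiniteTemperatureDeconfinement`
(`HasPolyakovLongRangeOrder`: every subsequential limit along even boxes fails to tend to `0`),
and equally by classical `O(N)`/Heisenberg long-range-order statements.

## Mathlib / tree status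

Mathlib has no infrared bounds or lattice Green functions (searched `infrared`, `GaussianDomination`,
`LongRangeOrder`); the finite Fourier analysis is the tree's (`torusFourier`, `torusChar`,
`torusFourier_inversion_holds`, `sum_sum_mul_torusFourierInv_re`), the Green functions and the
Cesàro lemma are the tree's (`torusGreen`, `latticeGreen`, `torusGreen_tendsto_latticeGreen`,
`tendsto_blockAverage_of_tendsto_cofinite`). The Ising-specific analogue of the upper-bound
direction is `Literature.Probability.LatticeModels.ads_gaussianDomination_of_infraredBound`
(`LroInfraredBound.lean`, not imported here).
-/

noncomputable section

open MeasureTheory Filter Topology Finset Real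
open scoped ComplexConjugate

namespace Literature.Probability.LatticeModels

variable {d : ℕ}

/-! ### Finite volume: positivity of `Ĝ`, the sum rule, block sums -/

section FiniteVolume

variable {L : ℕ} [NeZero L]

/-- **`Ĝ ≥ 0` for a positive-definite `G`** ("`Ĝ(p) ≥ 0` because `G` is clearly positive
definite"): if `Re ∑_{x,y} c_x c̄_y G(x - y) ≥ 0` for every complex `c` on `(ℤ/Lℤ)^d`, then
`Re Ĝ(k) ≥ 0` for every `k` (test with `c = χ̄_k`, for which the double sum is `L^d Ĝ(k)`). [cite: BorgsSeiler1983, §III.1 proof of Cor. III.5 (p. 347)] -/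
theorem torusFourier_re_nonneg_of_posSemidef (G : TorusSite d L → ℝ)
    (hPD : ∀ c : TorusSite d L → ℂ, 0 ≤ (∑ x, ∑ y, c x * conj (c y) * (G (x - y) : ℂ)).re)
    (k : TorusSite d L) : 0 ≤ (torusFourier (fun x => (G x : ℂ)) k).re := by
  have h := hPD fun x => conj (torusChar k x)
  have hsum : ∑ x, ∑ y, conj (torusChar k x) * conj (conj (torusChar k y)) * (G (x - y) : ℂ) =
      (L : ℂ) ^ d * torusFourier (fun x => (G x : ℂ)) k := by
    have hterm : ∀ x y, conj (torusChar k x) * conj (conj (torusChar k y)) * (G (x - y) : ℂ) =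
        (G (x - y) : ℂ) * conj (torusChar k (x - y)) := fun x y => by
      rw [Complex.conj_conj, torusChar_sub_right, map_mul, Complex.conj_conj]
      ring
    simp_rw [hterm]
    rw [Finset.sum_comm]
    have hinner : ∀ y, ∑ x, (G (x - y) : ℂ) * conj (torusChar k (x - y)) =
        torusFourier (fun x => (G x : ℂ)) k := fun y => by
      rw [torusFourier_eq_sum_torusChar]
      exact Equiv.sum_comp (Equiv.subRight y) fun z => (G z : ℂ) * conj (torusChar k z)
    simp_rw [hinner]
    rw [Finset.sum_const, Finset.card_univ, card_torusSite, nsmul_eq_mul]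
    push_cast
    ring
  rw [hsum] at h
  have hc : ((L : ℂ) ^ d) = (((L : ℝ) ^ d : ℝ) : ℂ) := by push_cast; ring
  rw [hc, Complex.re_ofReal_mul] at h
  have hLd : (0 : ℝ) < (L : ℝ) ^ d := by
    have : (0 : ℝ) < L := Nat.cast_pos.2 (Nat.pos_of_ne_zero (NeZero.ne L))
    positivity
  exact nonneg_of_mul_nonneg_right h hLd

/-- The torus Green function at the origin is `L^{-d} ∑_{k ≠ 0} ε(p_k)⁻¹`. [folklore] -/
theorem torusGreen_zero :
    torusGreen (0 : TorusSite d L) =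
      (∑ k ∈ (univ : Finset (TorusSite d L)).erase 0, (dispersion (latticeMomentum L k))⁻¹) /
        ((L : ℝ) ^ d) := by
  unfold torusGreen
  congr 1
  refine Finset.sum_congr rfl fun k _ => ?_
  simp [div_eq_inv_mul]

/-- **Fourier inversion at the origin** for a real `G`: `G(0) = L^{-d} ∑_k Re Ĝ(k)`. [folklore] -/
theorem eq_inv_mul_sum_torusFourier_re (G : TorusSite d L → ℝ) :
    G 0 = ((L : ℝ) ^ d)⁻¹ * ∑ k, (torusFourier (fun x => (G x : ℂ)) k).re := by
  have hinv : torusFourierInv (torusFourier fun x => (G x : ℂ)) 0 = (G 0 : ℂ) :=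
    congrFun (torusFourier_inversion_holds (d := d) (L := L) fun x => (G x : ℂ)) 0
  have h := congrArg Complex.re hinv
  rw [torusFourierInv_eq_sum_torusChar] at h
  simp only [torusChar_zero_right, mul_one, Complex.ofReal_re] at h
  rw [← h]
  have hc : (((L : ℂ) ^ d)⁻¹) = ((((L : ℝ) ^ d)⁻¹ : ℝ) : ℂ) := by push_cast; ring
  rw [hc, Complex.re_ofReal_mul, Complex.re_sum]

/-- **The sum rule.** An infrared bound `ε(p_k) Re Ĝ(k) ≤ B` off the zero mode gives
`G(0) - B · torusGreen 0 ≤ L^{-d} Re Ĝ(0)`: by Fourier inversion at the origin,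
`L^{-d} Re Ĝ(0) = G(0) - L^{-d} ∑_{k ≠ 0} Re Ĝ(k) ≥ G(0) - B L^{-d} ∑_{k ≠ 0} ε(p_k)⁻¹`
(Fröhlich–Simon–Spencer 1976, §3; Borgs–Seiler 1983, (III.24) and p. 348). [cite: BorgsSeiler1983, §III.1 proof of Cor. III.5 (pp. 347–348)] -/
theorem sub_mul_torusGreen_le_zeroMode (G : TorusSite d L → ℝ) {B : ℝ}
    (hIR : ∀ k : TorusSite d L, k ≠ 0 →
      dispersion (latticeMomentum L k) * (torusFourier (fun x => (G x : ℂ)) k).re ≤ B) :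
    G 0 - B * torusGreen (0 : TorusSite d L) ≤
      ((L : ℝ) ^ d)⁻¹ * (torusFourier (fun x => (G x : ℂ)) 0).re := by
  classical
  have hLd : (0 : ℝ) < (L : ℝ) ^ d := by
    have : (0 : ℝ) < L := Nat.cast_pos.2 (Nat.pos_of_ne_zero (NeZero.ne L))
    positivity
  have h0 := eq_inv_mul_sum_torusFourier_re G
  rw [← Finset.add_sum_erase _ _ (Finset.mem_univ (0 : TorusSite d L))] at h0
  -- the nonzero modes are controlled by the infrared bound
  have hterm : ∀ k ∈ (univ : Finset (TorusSite d L)).erase 0,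
      (torusFourier (fun x => (G x : ℂ)) k).re ≤ B * (dispersion (latticeMomentum L k))⁻¹ := by
    intro k hk
    have hk0 : k ≠ 0 := Finset.ne_of_mem_erase hk
    have hεpos : 0 < dispersion (latticeMomentum L k) :=
      lt_of_le_of_ne (dispersion_nonneg _)
        (fun h => hk0 ((dispersion_latticeMomentum_eq_zero_iff_holds k).1 h.symm))
    have h := hIR k hk0
    rw [mul_comm] at h
    rwa [← le_div_iff₀ hεpos, div_eq_mul_inv] at h
  have hsum : ∑ k ∈ (univ : Finset (TorusSite d L)).erase 0, (torusFourier (fun x => (G x : ℂ)) k).re ≤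
      B * ∑ k ∈ (univ : Finset (TorusSite d L)).erase 0, (dispersion (latticeMomentum L k))⁻¹ := by
    rw [Finset.mul_sum]
    exact Finset.sum_le_sum hterm
  have hkey : ((L : ℝ) ^ d)⁻¹ *
      ∑ k ∈ (univ : Finset (TorusSite d L)).erase 0, (torusFourier (fun x => (G x : ℂ)) k).re ≤
      B * torusGreen (0 : TorusSite d L) := by
    rw [torusGreen_zero, div_eq_mul_inv]
    calc ((L : ℝ) ^ d)⁻¹ *
        ∑ k ∈ (univ : Finset (TorusSite d L)).erase 0, (torusFourier (fun x => (G x : ℂ)) k).re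
        ≤ ((L : ℝ) ^ d)⁻¹ * (B * ∑ k ∈ (univ : Finset (TorusSite d L)).erase 0,
            (dispersion (latticeMomentum L k))⁻¹) :=
          mul_le_mul_of_nonneg_left hsum (inv_pos.2 hLd).le
      _ = B * ((∑ k ∈ (univ : Finset (TorusSite d L)).erase 0,
            (dispersion (latticeMomentum L k))⁻¹) * ((L : ℝ) ^ d)⁻¹) := by ring
  rw [h0, mul_add]
  linarith

/-- Push-forward of a block `Q ⊂ ℤ^d` to the torus: with the multiplicity weights
`w(a) = #{x ∈ Q : x̄ = a}` (`x̄ = x mod L`), `∑_a w(a) g(a) = ∑_{x ∈ Q} g(x̄)`. Elementary. [folklore] -/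
theorem sum_weight_mul_eq (Q : Finset (Site d)) (g : TorusSite d L → ℝ) :
    ∑ a, (∑ x ∈ Q, if Torus.proj L x = a then (1 : ℝ) else 0) * g a =
      ∑ x ∈ Q, g (Torus.proj L x) := by
  classical
  calc ∑ a, (∑ x ∈ Q, if Torus.proj L x = a then (1 : ℝ) else 0) * g a
      = ∑ a, ∑ x ∈ Q, (if Torus.proj L x = a then g a else 0) := by
        refine Finset.sum_congr rfl fun a _ => ?_
        rw [Finset.sum_mul]
        refine Finset.sum_congr rfl fun x _ => ?_
        split_ifs <;> simp
    _ = ∑ x ∈ Q, ∑ a, (if Torus.proj L x = a then g a else 0) := Finset.sum_comm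
    _ = ∑ x ∈ Q, g (Torus.proj L x) := by
        refine Finset.sum_congr rfl fun x _ => ?_
        rw [Finset.sum_ite_eq]
        simp only [Finset.mem_univ, if_true]

/-- The double-sum form: `∑_{a,b} w(a) w(b) f(a,b) = ∑_{x,y ∈ Q} f(x̄, ȳ)` (the same computation as
`Literature.Probability.LatticeModels.sum_pushforward_mul_pushforward` of `LroInfraredBound.lean`,
which this analysis file does not import). [folklore] -/
theorem sum_sum_weight_mul_eq_blockSum (Q : Finset (Site d)) (f : TorusSite d L → TorusSite d L → ℝ) :
    ∑ a, ∑ b, (∑ x ∈ Q, if Torus.proj L x = a then (1 : ℝ) else 0) *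
        (∑ y ∈ Q, if Torus.proj L y = b then (1 : ℝ) else 0) * f a b =
      ∑ x ∈ Q, ∑ y ∈ Q, f (Torus.proj L x) (Torus.proj L y) := by
  calc ∑ a, ∑ b, (∑ x ∈ Q, if Torus.proj L x = a then (1 : ℝ) else 0) *
        (∑ y ∈ Q, if Torus.proj L y = b then (1 : ℝ) else 0) * f a b
      = ∑ a, (∑ x ∈ Q, if Torus.proj L x = a then (1 : ℝ) else 0) *
          ∑ b, (∑ y ∈ Q, if Torus.proj L y = b then (1 : ℝ) else 0) * f a b := by
        refine Finset.sum_congr rfl fun a _ => ?_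
        rw [Finset.mul_sum]
        refine Finset.sum_congr rfl fun b _ => ?_
        ring
    _ = ∑ a, (∑ x ∈ Q, if Torus.proj L x = a then (1 : ℝ) else 0) * ∑ y ∈ Q, f a (Torus.proj L y) := by
        refine Finset.sum_congr rfl fun a _ => ?_
        rw [sum_weight_mul_eq Q (f a)]
    _ = ∑ x ∈ Q, ∑ y ∈ Q, f (Torus.proj L x) (Torus.proj L y) := sum_weight_mul_eq Q _

/-- The total weight of the push-forward of `Q` is `|Q|`. Elementary. [folklore] -/
theorem sum_weight_eq_card (Q : Finset (Site d)) :
    ∑ b, (∑ x ∈ Q, if Torus.proj L x = b then (1 : ℝ) else 0) = #Q := by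
  calc ∑ b, (∑ x ∈ Q, if Torus.proj L x = b then (1 : ℝ) else 0)
      = ∑ b, (∑ x ∈ Q, if Torus.proj L x = b then (1 : ℝ) else 0) * (fun _ => (1 : ℝ)) b := by
        simp only [mul_one]
    _ = ∑ x ∈ Q, (fun _ => (1 : ℝ)) (Torus.proj L x) := sum_weight_mul_eq Q _
    _ = #Q := by rw [Finset.sum_const, nsmul_one]

/-- **Block sums are bounded below by the zero mode.** If `Re Ĝ ≥ 0` and the infrared bound
`ε(p_k) Re Ĝ(k) ≤ B` holds for `k ≠ 0`, then for every finite `Q ⊂ ℤ^d`,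
`|Q|² (G(0) - B · torusGreen 0) ≤ ∑_{x,y ∈ Q} G(x̄ - ȳ)`: expand the block sum in characters,
`∑_{x,y ∈ Q} G(x̄ - ȳ) = L^{-d} ∑_k Re Ĝ(k) |ŵ(k)|²` (`w` the push-forward of `1_Q`), drop the
modes `k ≠ 0`, and use `|ŵ(0)|² = |Q|²` with the sum rule `sub_mul_torusGreen_le_zeroMode`. This
is the finite-volume content of "`c > 0` implies long range order". [cite: BorgsSeiler1983, §III.1 proof of Cor. III.5 (pp. 347–348)] -/
theorem sq_mul_le_blockSum (G : TorusSite d L → ℝ) {B : ℝ}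
    (hpos : ∀ k : TorusSite d L, 0 ≤ (torusFourier (fun x => (G x : ℂ)) k).re)
    (hIR : ∀ k : TorusSite d L, k ≠ 0 →
      dispersion (latticeMomentum L k) * (torusFourier (fun x => (G x : ℂ)) k).re ≤ B)
    (Q : Finset (Site d)) :
    (#Q : ℝ) ^ 2 * (G 0 - B * torusGreen (0 : TorusSite d L)) ≤
      ∑ x ∈ Q, ∑ y ∈ Q, G (Torus.proj L x - Torus.proj L y) := by
  classical
  set w : TorusSite d L → ℝ := fun b => ∑ x ∈ Q, if Torus.proj L x = b then (1 : ℝ) else 0 with hw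
  set Ghat : TorusSite d L → ℂ := torusFourier fun x => (G x : ℂ) with hGhat
  -- `G = Re 𝓕⁻¹ Ĝ`
  have hG : ∀ z, G z = (torusFourierInv Ghat z).re := fun z => by
    rw [hGhat, torusFourier_inversion_holds (d := d) (L := L) fun x => (G x : ℂ), Complex.ofReal_re]
  have hblock : ∑ x ∈ Q, ∑ y ∈ Q, G (Torus.proj L x - Torus.proj L y) =
      ((L : ℝ) ^ d)⁻¹ * ∑ k, (Ghat k).re * ‖torusFourier (fun x => (w x : ℂ)) k‖ ^ 2 := by
    rw [← sum_sum_weight_mul_eq_blockSum Q fun a b => G (a - b)]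
    simp_rw [hG]
    exact sum_sum_mul_torusFourierInv_re Ghat w
  have hLd : (0 : ℝ) < ((L : ℝ) ^ d)⁻¹ := by
    have : (0 : ℝ) < L := Nat.cast_pos.2 (Nat.pos_of_ne_zero (NeZero.ne L))
    positivity
  -- drop the nonzero modes
  have hdrop : (Ghat 0).re * ‖torusFourier (fun x => (w x : ℂ)) 0‖ ^ 2 ≤
      ∑ k, (Ghat k).re * ‖torusFourier (fun x => (w x : ℂ)) k‖ ^ 2 :=
    Finset.single_le_sum (f := fun k => (Ghat k).re * ‖torusFourier (fun x => (w x : ℂ)) k‖ ^ 2)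
      (fun k _ => mul_nonneg (hpos k) (by positivity)) (Finset.mem_univ 0)
  -- the zero mode of the weight is `|Q|`
  have hw0 : ‖torusFourier (fun x => (w x : ℂ)) 0‖ ^ 2 = (#Q : ℝ) ^ 2 := by
    rw [torusFourier_apply_zero, ← Complex.ofReal_sum, Complex.norm_real, Real.norm_eq_abs, sq_abs,
      hw, sum_weight_eq_card]
  rw [hw0] at hdrop
  have hzero := sub_mul_torusGreen_le_zeroMode G hIR
  calc (#Q : ℝ) ^ 2 * (G 0 - B * torusGreen (0 : TorusSite d L))
      ≤ (#Q : ℝ) ^ 2 * (((L : ℝ) ^ d)⁻¹ * (Ghat 0).re) :=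
        mul_le_mul_of_nonneg_left hzero (sq_nonneg _)
    _ = ((L : ℝ) ^ d)⁻¹ * ((Ghat 0).re * (#Q : ℝ) ^ 2) := by ring
    _ ≤ ((L : ℝ) ^ d)⁻¹ * ∑ k, (Ghat k).re * ‖torusFourier (fun x => (w x : ℂ)) k‖ ^ 2 :=
        mul_le_mul_of_nonneg_left hdrop hLd.le
    _ = ∑ x ∈ Q, ∑ y ∈ Q, G (Torus.proj L x - Torus.proj L y) := hblock.symm

end FiniteVolume

/-! ### The thermodynamic limit: long-range order -/

/-- `Torus.proj` is additive: `(x - y) mod L = x̄ - ȳ` (a private copy of the tree's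
`torusProj_sub` of `LroInfraredBound.lean`, not imported here). [folklore] -/
private theorem proj_sub_aux (L : ℕ) (x y : Site d) :
    Torus.proj L (x - y) = Torus.proj L x - Torus.proj L y := by
  funext i; simp [Torus.proj]

/-- `0 mod L = 0` (a private copy of the tree's `torusProj_zero` of `TorusZeroMode.lean`, not
imported here). [folklore] -/
private theorem proj_zero_aux (L : ℕ) : Torus.proj L (0 : Site d) = 0 := by
  funext i; simp [Torus.proj]

/-- **Block sums of a thermodynamic limit are bounded below.** Let `d ≥ 3` and let `G_n` be real
functions on the even tori `(ℤ/L_nℤ)^d`, `L_n = 2φ(n) + 2` with `φ` strictly increasing, such that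
eventually `Re Ĝ_n ≥ 0`, `G_n(0) ≥ g₀` and `ε(p_k) Re Ĝ_n(k) ≤ B` for `k ≠ 0`; let `G∞` be the
pointwise limit of `G_n(x mod L_n)` on `ℤ^d`. Then for every `N`,
`|Λ_N|² c ≤ ∑_{x,y ∈ Λ_N} G∞(x - y)` for every `c < g₀ - B · latticeGreen 0` (finite volume:
`sq_mul_le_blockSum`; `torusGreen 0 → latticeGreen 0` along even `L`:
`torusGreen_tendsto_latticeGreen`; then `n → ∞` in a finite sum). [cite: BorgsSeiler1983, §III.1 proof of Cor. III.5 (pp. 347–348)] -/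
theorem le_blockSum_of_tendsto (hd : 3 ≤ d) {φ : ℕ → ℕ} (hφ : StrictMono φ)
    (G : ∀ n : ℕ, TorusSite d (2 * φ n + 2) → ℝ) {g₀ B c : ℝ}
    (hc : c < g₀ - B * latticeGreen (0 : Site d))
    (hpos : ∀ᶠ n in atTop, ∀ k : TorusSite d (2 * φ n + 2),
      0 ≤ (torusFourier (fun x => (G n x : ℂ)) k).re)
    (hdiag : ∀ᶠ n in atTop, g₀ ≤ G n 0)
    (hIR : ∀ᶠ n in atTop, ∀ k : TorusSite d (2 * φ n + 2), k ≠ 0 →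
      dispersion (latticeMomentum (2 * φ n + 2) k) * (torusFourier (fun x => (G n x : ℂ)) k).re ≤ B)
    {Ginf : Site d → ℝ}
    (hlim : ∀ x : Site d, Tendsto (fun n => G n (Torus.proj (2 * φ n + 2) x)) atTop (𝓝 (Ginf x)))
    (N : ℕ) :
    (#(box d N) : ℝ) ^ 2 * c ≤ ∑ x ∈ box d N, ∑ y ∈ box d N, Ginf (x - y) := by
  -- `torusGreen 0` is eventually close to `latticeGreen 0`
  have hgap : 0 < g₀ - B * latticeGreen (0 : Site d) - c := by linarith
  obtain ⟨L₁, hL₁⟩ := torusGreen_tendsto_latticeGreen d hd (0 : Site d)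
    (ε := (g₀ - B * latticeGreen (0 : Site d) - c) / (|B| + 1)) (div_pos hgap (by positivity))
  have hGreen : ∀ᶠ n in atTop,
      c ≤ g₀ - B * torusGreen (0 : TorusSite d (2 * φ n + 2)) := by
    refine eventually_atTop.2 ⟨L₁, fun n hn => ?_⟩
    have hφn : n ≤ φ n := hφ.id_le n
    have hL : L₁ ≤ 2 * φ n + 2 := by omega
    have h := hL₁ (2 * φ n + 2) ⟨φ n + 1, by ring⟩ hL
    rw [proj_zero_aux] at h
    have hB : |B * torusGreen (0 : TorusSite d (2 * φ n + 2)) - B * latticeGreen (0 : Site d)| ≤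
        g₀ - B * latticeGreen (0 : Site d) - c := by
      rw [← mul_sub, abs_mul]
      calc |B| * |torusGreen (0 : TorusSite d (2 * φ n + 2)) - latticeGreen (0 : Site d)|
          ≤ |B| * ((g₀ - B * latticeGreen (0 : Site d) - c) / (|B| + 1)) :=
            mul_le_mul_of_nonneg_left h (abs_nonneg B)
        _ ≤ (|B| + 1) * ((g₀ - B * latticeGreen (0 : Site d) - c) / (|B| + 1)) :=
            mul_le_mul_of_nonneg_right (by linarith [abs_nonneg B]) (by positivity)
        _ = g₀ - B * latticeGreen (0 : Site d) - c := by
            field_simp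
    have := (abs_le.1 hB).2
    linarith
  -- finite volume, eventually in `n`
  have hfin : ∀ᶠ n in atTop, (#(box d N) : ℝ) ^ 2 * c ≤
      ∑ x ∈ box d N, ∑ y ∈ box d N, G n (Torus.proj (2 * φ n + 2) (x - y)) := by
    filter_upwards [hpos, hdiag, hIR, hGreen] with n hposn hdiagn hIRn hGreenn
    have h := sq_mul_le_blockSum (G n) hposn hIRn (box d N)
    simp_rw [proj_sub_aux]
    refine le_trans ?_ h
    exact mul_le_mul_of_nonneg_left (hGreenn.trans (by linarith)) (sq_nonneg _)
  -- pass to the limit in the finite double sum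
  have hsum : Tendsto (fun n => ∑ x ∈ box d N, ∑ y ∈ box d N,
      G n (Torus.proj (2 * φ n + 2) (x - y))) atTop
      (𝓝 (∑ x ∈ box d N, ∑ y ∈ box d N, Ginf (x - y))) :=
    tendsto_finsetSum _ fun x _ => tendsto_finsetSum _ fun y _ => hlim (x - y)
  exact ge_of_tendsto hsum hfin

variable (d) in
/-- **Long-range order from an infrared bound (`d ≥ 3`).** In the setting of
`le_blockSum_of_tendsto` — real functions `G_n` on the even tori `(ℤ/L_nℤ)^d`, `L_n = 2φ(n)+2 → ∞`,
eventually with `Re Ĝ_n ≥ 0` (e.g. positive definite, `torusFourier_re_nonneg_of_posSemidef`),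
diagonal lower bound `G_n(0) ≥ g₀` and infrared bound `ε(p_k) Re Ĝ_n(k) ≤ B` off the zero mode —
if `B · latticeGreen 0 < g₀` then NO pointwise limit `G∞` of `G_n(x mod L_n)` tends to `0` at
infinity on `ℤ^d`: its block averages stay `≥ (g₀ - B · latticeGreen 0)/2 > 0`, whereas a kernel
decaying at infinity has vanishing block averages (`tendsto_blockAverage_of_tendsto_cofinite`).
This is the Fröhlich–Simon–Spencer mechanism (CMP 50 (1976), §3) in the form used by
Borgs–Seiler: "In `d ≥ 3` [the infrared bounds] are compatible with [`∫ Ĝ ≥ 1`] only if `c > 0`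
… `c > 0` implies long range order, that is `lim G(x) ≠ 0`". [cite: BorgsSeiler1983, §III.1 proof of Cor. III.5 (pp. 347–348)] -/
theorem not_tendsto_zero_of_infraredBound (hd : 3 ≤ d) {φ : ℕ → ℕ} (hφ : StrictMono φ)
    (G : ∀ n : ℕ, TorusSite d (2 * φ n + 2) → ℝ) {g₀ B : ℝ}
    (hgap : B * latticeGreen (0 : Site d) < g₀)
    (hpos : ∀ᶠ n in atTop, ∀ k : TorusSite d (2 * φ n + 2),
      0 ≤ (torusFourier (fun x => (G n x : ℂ)) k).re)
    (hdiag : ∀ᶠ n in atTop, g₀ ≤ G n 0)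
    (hIR : ∀ᶠ n in atTop, ∀ k : TorusSite d (2 * φ n + 2), k ≠ 0 →
      dispersion (latticeMomentum (2 * φ n + 2) k) * (torusFourier (fun x => (G n x : ℂ)) k).re ≤ B)
    {Ginf : Site d → ℝ}
    (hlim : ∀ x : Site d, Tendsto (fun n => G n (Torus.proj (2 * φ n + 2) x)) atTop (𝓝 (Ginf x))) :
    ¬ Tendsto Ginf cofinite (𝓝 0) := by
  intro hzero
  set c : ℝ := (g₀ - B * latticeGreen (0 : Site d)) / 2 with hc
  have hc_pos : 0 < c := by rw [hc]; linarith
  have hc_lt : c < g₀ - B * latticeGreen (0 : Site d) := by rw [hc]; linarith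
  have hblock := le_blockSum_of_tendsto hd hφ G hc_lt hpos hdiag hIR hlim
  have havg : ∀ N : ℕ, c ≤
      (∑ x ∈ box d N, ∑ y ∈ box d N, Ginf (x - y)) / ((#(box d N) : ℝ) ^ 2) := by
    intro N
    have hB : (0 : ℝ) < (#(box d N) : ℝ) ^ 2 := by
      have : (0 : ℝ) < #(box d N) := by exact_mod_cast (box_nonempty d N).card_pos
      exact pow_pos this 2
    rw [le_div_iff₀ hB, mul_comm]
    exact hblock N
  have hlim0 := tendsto_blockAverage_of_tendsto_cofinite d (by omega) hzero
  have := ge_of_tendsto' hlim0 havg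
  linarith

end Literature.Probability.LatticeModels

end
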